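import Literature.NumberTheory.Automorphic.UnitaryGroupDoubledBigCellGeneric
import Literature.NumberTheory.Automorphic.UnitaryGroupNonsplitPlace
import Literature.NumberTheory.Automorphic.QuadraticLocalBaseChange
import HarnessLib

/-!
# The big cell of the doubled unitary group `U(𝕍 ⊕ −𝕍)(F_v)` is left-generic at a non-split place

Topic `NumberTheory/Automorphic`; namespaces `Literature.NumberTheory.Automorphic.UnitaryGroup` (§1) and
`Literature.NumberTheory.Automorphic.DoubledUnitary` (§2–§3; sequel of `UnitaryGroupDoubledBigCellGeneric`).  KERNEL only:
proved lemmas; no named fact, no `sorry`.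

Setting: `E/F` a quadratic extension of number fields, `c ∈ Aut(E/F)` and `δ ∈ E` with `c δ = −δ ≠ 0` (so `c ≠ 1`); a finite place
`v` of `F` and a place `w ∣ v` of `E` with `c • w = w` (a NON-SPLIT place), so that `E ⊗_F F_v = Π_{w' ∣ v} E_{w'}` (the tree's
`UnitaryGroup.LocalRing E v`) is a FIELD (`LocalRing.isField_of_smul_eq`), infinite, with the involution `c ⊗ 1 = conjLocal`
(`conjLocal_conjLocal`, §1) and the element `θ = δ ⊗ 1`, `(c ⊗ 1) θ = −θ ≠ 0`; and the doubled hermitian form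
`J^𝔻 = (reindex e e (T₀ ⊕ −T₀)) ⊗ 1 ∈ M_N(E)` of an `F`-rational symmetric invertible `T₀ ∈ GL_ι(F)` (`e : ι ⊕ ι ≃ Fin N`; the
tree's `gramD F n T₀` is the case `e = finSumFinEquiv`).

MAIN RESULT (§2–§3): **the big cell `Ω = {h ∣ C(h) invertible}` of `H(F_v) = U(J^𝔻)(F_v)` — `C` the `Δ → Δ⁻` adapted block of
`GelbartRogawski1991/DoubledUnitaryAdaptedBlocks` — is LEFT-GENERIC** (`Literature.GroupTheory.IsLeftGeneric`: every finite family
of elements has a common left translate inside `Ω`; the hypothesis of Weil's group-chunk Lemme 6 [Weil1964, n° 42], used for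
`P w P ⊆ U(n,n)(F_v)` in [Kudla1994, §3] ∕ [HarrisKudlaSweet1996, §1]) in each of the tree's three spellings of the local group:
`«local» E c N J v ≤ GL_N(E ⊗ F_v)` (`isLeftGeneric_local_isUnit_blkC`), the factor form `localPi E c N J v ≤ Π_{w' ∣ v} GL_N(E_{w'})`
with `C` read over `E ⊗ F_v` (`isLeftGeneric_localPi_isUnit_blkC`) or at the component `w` (`isLeftGeneric_localPi_isUnit_blkC_apply`).
This is the field-level theorem `isLeftGeneric_isUnit_blkC_subtype` of `UnitaryGroupDoubledBigCellGeneric` at `K = E ⊗ F_v`,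
`σ = c ⊗ 1`, `θ = δ ⊗ 1`, `S = T₀ ⊗ 1`, pulled back along `localPiEquiv : localPi ≃ «local»` (`IsLeftGeneric.comap`).

Written as brick L4d (the glue of stub J1 `stub_J1_leftGeneric` of GR-1's local skeleton to L4c: with the reading of the big cell
`Ω_H = {h ∣ ι(h) ℓ_Δ ⋔ ℓ_Δ}` as `{C(h) invertible}`, Kudla's splitting on the big cell extends to `H(F_v)` by `GroupChunkExtension`) of
the kernel construction of [GelbartRogawski1991, Prop. 3.1.1] (stage-1 cell `pub-hodgecm`, seats GR-1 ∕ GR-2; this file: seat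
carch-1, 2026-08-21).

## References

* A. Weil, *Sur certains groupes d'opérateurs unitaires*, Acta Math. 111 (1964) 143–211, n° 42 (Lemme 6 and the remark
  following it, pp. 195–196) [Weil1964].
* S. S. Kudla, Israel J. Math. 87 (1994) 361–401, §3 [Kudla1994].
* M. Harris, S. S. Kudla, W. J. Sweet, J. Amer. Math. Soc. 9 (1996) 941–1004, §1 (1.11)–(1.14) [HarrisKudlaSweet1996].
* J. W. S. Cassels, A. Fröhlich (eds.), *Algebraic Number Theory* (1967), Ch. II §10, Ch. VII §1.1 [CasselsFrohlichANT1967].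
* V. Platonov, A. Rapinchuk, *Algebraic Groups and Number Theory* (1994), §5.1 [PlatonovRapinchuk1994].
-/

set_option autoImplicit false

noncomputable section

open scoped Matrix MatrixGroups
open NumberField IsDedekindDomain Matrix

namespace Literature.NumberTheory.Automorphic

/-! ## §1 `c ⊗ 1` is an involution of `E ⊗_F F_v` -/

namespace UnitaryGroup

variable {F E : Type} [Field F] [NumberField F] [Field E] [NumberField E] [Algebra F E]
variable (c : E ≃ₐ[F] E)

/-- **`(c ⊗ 1) ∘ (c ⊗ 1) = id` on `E ⊗_F F_v = Π_{w ∣ v} E_w`** (in the coordinates `E ⊗ F_v = F_v ⊕ F_v δ` of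
`quadraticLocalEquiv`, `c ⊗ 1` is `(a, b) ↦ (a, −b)`). [cite: CasselsFrohlichANT1967, Ch. VII §1.1] -/
theorem conjLocal_conjLocal [Algebra.IsQuadraticExtension F E] (v : HeightOneSpectrum (𝓞 F)) {δ : E} (hcδ : c δ = -δ)
    (hδ : δ ≠ 0) (x : LocalRing E v) : conjLocal E c v (conjLocal E c v x) = x := by
  obtain ⟨p, rfl⟩ := (quadraticLocalEquiv E v c hcδ hδ).surjective x
  obtain ⟨a, b⟩ := p
  rw [conjLocal_quadraticLocalEquiv, conjLocal_quadraticLocalEquiv, neg_neg]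

omit [NumberField F] in
/-- the local form matrix of `J ∈ M_N(E)` is `J ⊗ 1 ∈ M_N(E ⊗ F_v)` (definitional unfolding of `adelicForm`, `adeleToLocal`).
[folklore] -/
private theorem localForm_eq_map_algebraMap (v : HeightOneSpectrum (𝓞 F)) (N : ℕ) (J : Matrix (Fin N) (Fin N) E) :
    (adelicForm E N J).map (adeleToLocal E v) = J.map (algebraMap E (LocalRing E v)) := by
  rw [adelicForm, Matrix.map_map]
  rfl

end UnitaryGroup

namespace DoubledUnitary

open Literature.GroupTheory (IsLeftGeneric)
open UnitaryGroup GelbartRogawski1991.AdaptedBlocks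

/-! ## §2 Generic algebra: the `C`-block condition under ring homomorphisms -/

section Algebra

variable {L L' : Type*} {ι : Type*}

/-- `C(M) = ½ (M₁₁ + M₁₂ − M₂₁ − M₂₂)` is invertible iff `M₁₁ + M₁₂ − M₂₁ − M₂₂` is (`½` is a unit). [folklore] -/
private theorem isUnit_blkC_iff [CommRing L] [Fintype ι] [DecidableEq ι] [Invertible (2 : L)]
    (M : Matrix (ι ⊕ ι) (ι ⊕ ι) L) :
    IsUnit (blkC M) ↔ IsUnit (M.toBlocks₁₁ + M.toBlocks₁₂ - M.toBlocks₂₁ - M.toBlocks₂₂) := by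
  rw [blkC, Matrix.isUnit_iff_isUnit_det, Matrix.isUnit_iff_isUnit_det, Matrix.det_smul, IsUnit.mul_iff,
    and_iff_right ((isUnit_of_invertible (⅟(2 : L))).pow _)]

/-- `M₁₁ + M₁₂ − M₂₁ − M₂₂` commutes with entrywise ring homomorphisms. [folklore] -/
private theorem blocksC_map [CommRing L] [CommRing L'] (f : L →+* L') (M : Matrix (ι ⊕ ι) (ι ⊕ ι) L) :
    (M.toBlocks₁₁ + M.toBlocks₁₂ - M.toBlocks₂₁ - M.toBlocks₂₂).map f =
      (M.map f).toBlocks₁₁ + (M.map f).toBlocks₁₂ - (M.map f).toBlocks₂₁ - (M.map f).toBlocks₂₂ := by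
  ext i j
  simp only [Matrix.map_apply, Matrix.sub_apply, Matrix.add_apply, Matrix.toBlocks₁₁, Matrix.toBlocks₁₂,
    Matrix.toBlocks₂₁, Matrix.toBlocks₂₂, Matrix.of_apply, map_sub, map_add]

/-- `reindex` commutes with entrywise maps. [folklore] -/
private theorem reindex_map {m : Type*} (e e' : m ≃ ι ⊕ ι) (f : L → L') (M : Matrix m m L) :
    (Matrix.reindex e e' M).map f = Matrix.reindex e e' (M.map f) := by
  rw [Matrix.reindex_apply, Matrix.reindex_apply, Matrix.submatrix_map]

/-- `(reindex e e (T ⊕ −T)) ⊗ 1 = reindex e e ((T ⊗ 1) ⊕ −(T ⊗ 1))` for a ring homomorphism. [folklore] -/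
private theorem reindex_fromBlocks_diag_map [CommRing L] [CommRing L'] {m : Type*} (e : ι ⊕ ι ≃ m) (f : L →+* L')
    (T : Matrix ι ι L) :
    (Matrix.reindex e e (Matrix.fromBlocks T 0 0 (-T))).map f =
      Matrix.reindex e e (Matrix.fromBlocks (T.map f) 0 0 (-(T.map f))) := by
  rw [Matrix.reindex_apply, Matrix.reindex_apply, ← Matrix.submatrix_map, Matrix.fromBlocks_map,
    Matrix.map_zero _ (map_zero f), Matrix.map_neg _ (map_neg f)]

end Algebra

/-! ## §3 The big cell of `U(J^𝔻)(F_v)` at a non-split place -/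

section Nonsplit

variable {F E : Type} [Field F] [NumberField F] [Field E] [NumberField E] [Algebra F E] [Algebra.IsQuadraticExtension F E]
variable (c : E ≃ₐ[F] E) {δ : E} (hcδ : c δ = -δ) (hδ : δ ≠ 0)
variable (v : HeightOneSpectrum (𝓞 F)) (w : PlacesOver E v) (hw : c • w.1 = w.1)
variable {ι : Type*} [Fintype ι] [DecidableEq ι] {N : ℕ} (e : ι ⊕ ι ≃ Fin N)
variable {T₀ : Matrix ι ι F} (hT₀ : T₀.IsSymm) (hT₀d : IsUnit T₀.det)
variable {J : Matrix (Fin N) (Fin N) E} (hJ : J = (Matrix.reindex e e (Matrix.fromBlocks T₀ 0 0 (-T₀))).map (algebraMap F E))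

include hcδ hδ hw hT₀ hT₀d hJ

/-- **the big cell of `U(J^𝔻)(F_v) ≤ GL_N(E ⊗ F_v)` is left-generic at a non-split place** (`«local»` model): for every finite
family `T ⊆ U(J^𝔻)(F_v)` there is `x` in the group with `C(reindex e⁻¹ e⁻¹ (x t))` invertible for all `t ∈ T`, `C` the `Δ → Δ⁻`
adapted block over `E ⊗ F_v`.  (`isLeftGeneric_isUnit_blkC_subtype` at the field `K = E ⊗ F_v`, `σ = c ⊗ 1`, `θ = δ ⊗ 1`,
`S = T₀ ⊗ 1`.)  The `Invertible 2` structure on `E ⊗ F_v` defining `C` is an arbitrary instance argument.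
[cite: Kudla1994, §3; Weil1964, n° 42 (after Lemme 6), p. 196] -/
theorem isLeftGeneric_local_isUnit_blkC [Invertible (2 : LocalRing E v)] :
    IsLeftGeneric {g : ↥(«local» E c N J v) |
      IsUnit (blkC (Matrix.reindex e.symm e.symm ((g : GL (Fin N) (LocalRing E v)) : Matrix (Fin N) (Fin N) (LocalRing E v))))} := by
  have hc : c ≠ 1 := by
    rintro rfl
    rw [AlgEquiv.one_apply] at hcδ
    exact hδ (add_self_eq_zero.1 (eq_neg_iff_add_eq_zero.1 hcδ))
  letI : Field (LocalRing E v) := (LocalRing.isField_of_smul_eq c hc w hw).toField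
  haveI : Infinite E := CharZero.infinite E
  haveI : Infinite (LocalRing E v) := Infinite.of_injective _ (algebraMap E (LocalRing E v)).injective
  -- the data of `UnitaryGroupDoubledBigCellGeneric` at `K = E ⊗ F_v`
  let φ : F →+* LocalRing E v := (algebraMap E (LocalRing E v)).comp (algebraMap F E)
  have hσ : ∀ x, conjLocal E c v (conjLocal E c v x) = x := conjLocal_conjLocal c v hcδ hδ
  have hθ : conjLocal E c v (algebraMap E (LocalRing E v) δ) = -algebraMap E (LocalRing E v) δ := by
    rw [conjLocal_algebraMap, hcδ, map_neg]
  have hθ0 : algebraMap E (LocalRing E v) δ ≠ 0 := (_root_.map_ne_zero _).2 hδ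
  have hφσ : ∀ t : F, conjLocal E c v (φ t) = φ t := fun t => by
    show conjLocal E c v (algebraMap E (LocalRing E v) (algebraMap F E t)) = algebraMap E (LocalRing E v) (algebraMap F E t)
    rw [conjLocal_algebraMap, AlgEquiv.commutes]
  have hSσ : (T₀.map φ).map (conjLocal E c v) = T₀.map φ := Matrix.ext fun i j => hφσ (T₀ i j)
  have hSs : (T₀.map φ)ᵀ = T₀.map φ := by rw [← Matrix.transpose_map, hT₀.eq]
  have hSu : IsUnit (T₀.map φ).det := by
    rw [← RingHom.mapMatrix_apply, ← RingHom.map_det]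
    exact hT₀d.map _
  have hform : (adelicForm E N J).map (adeleToLocal E v) =
      Matrix.reindex e e (Matrix.fromBlocks (T₀.map φ) 0 0 (-(T₀.map φ))) := by
    rw [localForm_eq_map_algebraMap, hJ, Matrix.map_map]
    exact reindex_fromBlocks_diag_map e φ T₀
  exact isLeftGeneric_isUnit_blkC_subtype (conjLocal E c v) e hσ hθ hθ0 hSσ hSs hSu _ hform

/-- **the big cell of `U(J^𝔻)(F_v)` is left-generic at a non-split place — factor form `localPi E c N J v ≤ Π_{w' ∣ v} GL_N(E_{w'})`,
`C` read over `E ⊗ F_v`**: the set of `h` whose regrouped matrix `(h_{w'})_{w'} ∈ GL_N(E ⊗ F_v)` (`= ↑(localPiEquiv … h)`,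
`coe_localPiEquiv_apply`) has `C(reindex e⁻¹ e⁻¹ ·)` invertible is left-generic (pull-back of `isLeftGeneric_local_isUnit_blkC` along
`localPiEquiv`).  Stub J1 of the GR-1 local package is this set read as `Ω_H = {h ∣ ι(h) ℓ_Δ ⋔ ℓ_Δ}` (`IsLeftGeneric.mono`).
[cite: Kudla1994, §3; Weil1964, n° 42 (after Lemme 6), p. 196; PlatonovRapinchuk1994, §5.1] -/
theorem isLeftGeneric_localPi_isUnit_blkC [Invertible (2 : LocalRing E v)] :
    IsLeftGeneric {h : ↥(localPi E c N J v) |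
      IsUnit (blkC (Matrix.reindex e.symm e.symm
        (((localGLPiEquiv E N v).symm (h : LocalGLPi E N v) : GL (Fin N) (LocalRing E v)) :
          Matrix (Fin N) (Fin N) (LocalRing E v))))} :=
  (isLeftGeneric_local_isUnit_blkC c hcδ hδ v w hw e hT₀ hT₀d hJ).comap (localPiEquiv E c N J v).toMulEquiv.toMonoidHom
    (localPiEquiv E c N J v).surjective

/-- **the big cell of `U(J^𝔻)(F_v)` is left-generic at a non-split place — factor form, `C` read at the component `w`**: the set
of `h = (h_{w'})_{w' ∣ v}` with `C(reindex e⁻¹ e⁻¹ h_w) ∈ M_ι(E_w)` invertible is left-generic (image of the previous set under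
the evaluation `E ⊗ F_v → E_w`; `GLn.map_piEquiv_symm`).  The `Invertible 2` structure on `E_w` is an arbitrary instance argument.
[cite: Kudla1994, §3; Weil1964, n° 42 (after Lemme 6), p. 196; PlatonovRapinchuk1994, §5.1] -/
theorem isLeftGeneric_localPi_isUnit_blkC_apply [Invertible (2 : w.1.adicCompletion E)] :
    IsLeftGeneric {h : ↥(localPi E c N J v) |
      IsUnit (blkC (Matrix.reindex e.symm e.symm
        (((h : LocalGLPi E N v) w : GL (Fin N) (w.1.adicCompletion E)) : Matrix (Fin N) (Fin N) (w.1.adicCompletion E))))} := by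
  haveI : Invertible (2 : E) := invertibleOfNonzero two_ne_zero
  haveI : Invertible (2 : LocalRing E v) :=
    (Invertible.map (algebraMap E (LocalRing E v)) 2).copy _ (map_ofNat (algebraMap E (LocalRing E v)) 2).symm
  refine (isLeftGeneric_localPi_isUnit_blkC c hcδ hδ v w hw e hT₀ hT₀d hJ).mono fun h hh => ?_
  rw [Set.mem_setOf_eq, isUnit_blkC_iff] at hh ⊢
  have h2 := hh.map (RingHom.mapMatrix (Pi.evalRingHom (fun w' : PlacesOver E v => w'.1.adicCompletion E) w))
  rw [RingHom.mapMatrix_apply, blocksC_map, reindex_map, GLn.map_piEquiv_symm] at h2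
  exact h2

end Nonsplit

end DoubledUnitary

end Literature.NumberTheory.Automorphic
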